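import Mathlib.AlgebraicGeometry.FunctionField
import Mathlib.AlgebraicGeometry.AffineScheme
import HarnessLib

/-!
# Sections over a union of basic opens of an affine open, inside the function field — file L4b of the `S2Modification` discharge
# (crux `FInjectiveMacaulayfication` stmt-ResolutionOfSingularities-15315, chain w45a, hole #3γ/FC″, rung r2 input S-S2
# `FCForallExistsDimLe2.S2Modification`; the `hrange` input of `…S2ModificationAffineSections` (L4a, p554033) for the chart rings of
# Mathlib's relative normalisation `Scheme.Hom.normalization`; res-L1-w45a-plan-1 R13.46 / R15.18 «stub-2 … L4»; seat res-L1-w45a-stub-2)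

[OURS · L1 W4.5a] Support file (`--supports stmt-ResolutionOfSingularities-15315 --as helper`); NOT a statement of any manuscript; no named
fact; no definitions; AI-written (AI review is weaker than expert review).

THE STATEMENT. `X` an integral scheme, `U ⊆ X` an affine open, `s` a finite set of NON-ZERO sections `f ∈ Γ(X, U)`, and
`W := ⋃_{f ∈ s} X.basicOpen f ⊆ U` (the complement in `U` of the zero locus of `s`). Inside the function field `K(X)`:

  **`Γ(X, W) = ⋂_{f ∈ s} Γ(X, U)[1/f]`** — `mem_range_germToFunctionField_iSup_iff`:
  `z ∈ range (Γ(X, W) → K(X)) ↔ ∀ f ∈ s, ∃ a n, z = a / fⁿ` (with `a ∈ Γ(X, U)`),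

and `Γ(X, W) → K(X)` is injective (Mathlib `Scheme.germToFunctionField_injective`). Proof: (⊆) the restriction of a section to
`X.basicOpen f` lies in `Γ(X, X.basicOpen f) = Γ(X, U)[1/f]` (Mathlib `IsAffineOpen.isLocalization_basicOpen`); (⊇) the local sections
`a_f / f^{n_f}` on the `X.basicOpen f` have the same germ `z` at the generic point, hence agree on overlaps
(`germToFunctionField_injective`), and the sheaf glues them (`TopCat.Sheaf.existsUnique_gluing'`; pattern of the tree's
`NormalSectionsIntegrallyClosed`).

USE (L4 of the S₂-modification): with `A = Γ(X₂, U)`, `K = K(X₂)` and `F ∩ U = zeroLocus s`, the ring `B₀ = Γ(X₂ ∖ F, U ∖ F) = Γ(X₂, W)`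
is the ring Mathlib's `(X₂ ∖ F).ι.normalization` takes the integral closure of `A` in; this file's range statement is exactly the
hypothesis `hrange` of `S2ModificationAffineSections.exists_algEquiv_integralClosure_s2Mod`, which identifies that integral closure with
`S2ModificationAffine.s2Mod A K s hs`.

[folklore] [cite: EGAIV2, 5.10.16–17]
-/

-- single-problem summit: the doubled namespace component is forced
set_option linter.dupNamespace false

noncomputable section

namespace Summit.ResolutionOfSingularities.ResolutionOfSingularities.Theorems.FInjectiveMacaulayfication.S2ModificationSections

open CategoryTheory AlgebraicGeometry TopologicalSpace Opposite

universe u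

variable {X : Scheme.{u}} [IsIntegral X] {U : X.Opens}

/-! ## §1 Basic opens of non-zero sections are non-empty -/

/-- The generic point lies in a non-empty open. [folklore] -/
theorem genericPoint_mem (U : X.Opens) [h : Nonempty U] : genericPoint X ∈ U :=
  ((genericPoint_spec X).mem_open_set_iff U.isOpen).mpr (by simpa using h)

/-- **A non-zero section does not vanish at the generic point**: `genericPoint X ∈ X.basicOpen f` for `f ≠ 0` (`X` integral,
`U` non-empty). [folklore] -/
theorem genericPoint_mem_basicOpen [Nonempty U] (f : Γ(X, U)) (hf : f ≠ 0) : genericPoint X ∈ X.basicOpen f := by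
  rw [Scheme.mem_basicOpen (hx := genericPoint_mem U)]
  have hne : X.germToFunctionField U f ≠ 0 := fun h =>
    hf (X.germToFunctionField_injective U (by rw [h, map_zero]))
  exact isUnit_iff_ne_zero.mpr hne

/-- `X.basicOpen f` is non-empty for `f ≠ 0`. [folklore] -/
theorem nonempty_basicOpen [Nonempty U] (f : Γ(X, U)) (hf : f ≠ 0) : Nonempty (X.basicOpen f) :=
  ⟨⟨_, genericPoint_mem_basicOpen f hf⟩⟩

/-- `⋃_{f ∈ s} X.basicOpen f` is non-empty for a non-empty finite set `s` of non-zero sections. [folklore] -/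
theorem nonempty_iSup_basicOpen [Nonempty U] (s : Finset Γ(X, U)) (hs : ∀ f ∈ s, f ≠ 0) (hne : s.Nonempty) :
    Nonempty (⨆ f : s, X.basicOpen (f : Γ(X, U)) : X.Opens) := by
  obtain ⟨f, hf⟩ := hne
  exact ⟨⟨genericPoint X, Opens.mem_iSup.mpr ⟨⟨f, hf⟩, genericPoint_mem_basicOpen f (hs f hf)⟩⟩⟩

omit [IsIntegral X] in
/-- `⋃_{f ∈ s} X.basicOpen f ⊆ U`. [folklore] -/
theorem iSup_basicOpen_le (s : Finset Γ(X, U)) : (⨆ f : s, X.basicOpen (f : Γ(X, U)) : X.Opens) ≤ U :=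
  iSup_le fun f => X.basicOpen_le (f : Γ(X, U))

/-! ## §2 Germs at the generic point of sections over basic opens -/

/-- The germ at the generic point does not see restriction. [folklore] -/
theorem germToFunctionField_map {V W : X.Opens} [Nonempty V] [Nonempty W] (i : V ≤ W) (σ : Γ(X, W)) :
    X.germToFunctionField V (X.presheaf.map (homOfLE i).op σ) = X.germToFunctionField W σ := by
  dsimp only [Scheme.germToFunctionField]
  rw [TopCat.Presheaf.germ_res_apply]

/-- The structure map `Γ(X, U) → Γ(X, X.basicOpen f)` (Mathlib's `algebra_section_section_basicOpen`) followed by the germ at the generic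
point is the germ at the generic point. [folklore] -/
theorem germToFunctionField_algebraMap_basicOpen [Nonempty U] (f : Γ(X, U)) [Nonempty (X.basicOpen f)] (a : Γ(X, U)) :
    X.germToFunctionField (X.basicOpen f) (algebraMap Γ(X, U) Γ(X, X.basicOpen f) a) = X.germToFunctionField U a := by
  rw [RingHom.algebraMap_toAlgebra]
  exact germToFunctionField_map (X.basicOpen_le f) a

/-- `germ (f ^ n) ≠ 0` in `K(X)` for `f ≠ 0`. [folklore] -/
theorem germToFunctionField_pow_ne_zero [Nonempty U] (f : Γ(X, U)) (hf : f ≠ 0) (n : ℕ) :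
    X.germToFunctionField U (f ^ n) ≠ 0 := by
  rw [map_pow]
  exact pow_ne_zero n fun h => hf (X.germToFunctionField_injective U (by rw [h, map_zero]))

/-! ## §3 `Γ(X, ⋃ X.basicOpen f) ⊆ ⋂ Γ(X, U)[1/f]` -/

/-- **A section over `W ⊇ X.basicOpen f` is `a / fⁿ` in `K(X)`** (`a ∈ Γ(X, U)`): its restriction to `X.basicOpen f` lies in
`Γ(X, X.basicOpen f) = Γ(X, U)[1/f]`. [folklore] -/
theorem exists_eq_div_of_basicOpen_le (hU : IsAffineOpen U) [Nonempty U] {W : X.Opens} [Nonempty W] (f : Γ(X, U)) (hf : f ≠ 0)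
    (hfW : X.basicOpen f ≤ W) (σ : Γ(X, W)) :
    ∃ (a : Γ(X, U)) (n : ℕ), X.germToFunctionField W σ =
      X.germToFunctionField U a * (X.germToFunctionField U (f ^ n))⁻¹ := by
  haveI := nonempty_basicOpen f hf
  haveI := hU.isLocalization_basicOpen f
  obtain ⟨⟨a, ⟨_, n, rfl⟩⟩, h⟩ := IsLocalization.surj (Submonoid.powers f) (X.presheaf.map (homOfLE hfW).op σ)
  -- `h : σ|_{D(f)} * f ^ n = a` in `Γ(X, X.basicOpen f)`
  refine ⟨a, n, ?_⟩
  have h' := congrArg (X.germToFunctionField (X.basicOpen f)) h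
  rw [map_mul, germToFunctionField_map, germToFunctionField_algebraMap_basicOpen,
    germToFunctionField_algebraMap_basicOpen] at h'
  rw [← h', mul_assoc, mul_inv_cancel₀ (germToFunctionField_pow_ne_zero f hf n), mul_one]

/-! ## §4 `⋂ Γ(X, U)[1/f] ⊆ Γ(X, ⋃ X.basicOpen f)`: gluing -/

/-- **A rational function that is `a_f / f^{n_f}` for every `f ∈ s` is a section over `⋃_{f ∈ s} X.basicOpen f`**: the local sections
`a_f / f^{n_f} ∈ Γ(X, X.basicOpen f)` have germ `z` at the generic point, agree on overlaps, and glue. [folklore] -/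
theorem exists_germToFunctionField_eq_of_forall (hU : IsAffineOpen U) [Nonempty U] (s : Finset Γ(X, U)) (hs : ∀ f ∈ s, f ≠ 0)
    (hne : s.Nonempty) (z : X.functionField)
    (hz : ∀ (f : Γ(X, U)) (_ : f ∈ s), ∃ (a : Γ(X, U)) (n : ℕ),
      z = X.germToFunctionField U a * (X.germToFunctionField U (f ^ n))⁻¹) :
    ∃ σ : Γ(X, ⨆ f : s, X.basicOpen (f : Γ(X, U))),
      X.germToFunctionField (⨆ f : s, X.basicOpen (f : Γ(X, U))) (h := nonempty_iSup_basicOpen s hs hne) σ = z := by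
  classical
  choose a n haz using hz
  -- the cover and the local sections `a_f / f^{n_f}`
  let W : s → X.Opens := fun f => X.basicOpen (f : Γ(X, U))
  have hWne : ∀ f : s, Nonempty (W f) := fun f => nonempty_basicOpen (f : Γ(X, U)) (hs f.1 f.2)
  have hloc : ∀ f : s, IsLocalization.Away (f : Γ(X, U)) Γ(X, W f) := fun f => hU.isLocalization_basicOpen (f : Γ(X, U))
  let t : ∀ f : s, Γ(X, W f) := fun f =>
    haveI := hloc f
    IsLocalization.mk' (M := Submonoid.powers (f : Γ(X, U))) Γ(X, W f) (a f.1 f.2)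
      ⟨(f : Γ(X, U)) ^ n f.1 f.2, n f.1 f.2, rfl⟩
  -- each local section has germ `z` at the generic point
  have hgen : ∀ f : s, X.germToFunctionField (W f) (h := hWne f) (t f) = z := by
    intro f
    haveI := hWne f
    haveI := hloc f
    have h := IsLocalization.mk'_spec (M := Submonoid.powers (f : Γ(X, U))) Γ(X, W f) (a f.1 f.2)
      ⟨(f : Γ(X, U)) ^ n f.1 f.2, n f.1 f.2, rfl⟩
    have h' := congrArg (X.germToFunctionField (W f)) h
    rw [map_mul, germToFunctionField_algebraMap_basicOpen, germToFunctionField_algebraMap_basicOpen] at h'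
    rw [haz f.1 f.2, ← h', mul_assoc, mul_inv_cancel₀ (germToFunctionField_pow_ne_zero _ (hs f.1 f.2) _), mul_one]
  -- compatibility on overlaps: equal germs at the generic point
  have hcompat : TopCat.Presheaf.IsCompatible X.presheaf W t := by
    intro i j
    haveI : Nonempty (W i ⊓ W j : X.Opens) :=
      ⟨⟨genericPoint X, ⟨genericPoint_mem_basicOpen _ (hs i.1 i.2), genericPoint_mem_basicOpen _ (hs j.1 j.2)⟩⟩⟩
    apply X.germToFunctionField_injective (W i ⊓ W j)
    change X.germToFunctionField (W i ⊓ W j) (X.presheaf.map (homOfLE inf_le_left).op (t i)) =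
      X.germToFunctionField (W i ⊓ W j) (X.presheaf.map (homOfLE inf_le_right).op (t j))
    haveI := hWne i
    haveI := hWne j
    rw [germToFunctionField_map, germToFunctionField_map, hgen i, hgen j]
  -- glue
  obtain ⟨σ, hσ, -⟩ := TopCat.Sheaf.existsUnique_gluing' X.sheaf W (⨆ f : s, X.basicOpen (f : Γ(X, U)))
    (fun f => homOfLE (le_iSup W f)) le_rfl t hcompat
  refine ⟨σ, ?_⟩
  obtain ⟨f₀, hf₀⟩ := hne
  haveI := hWne ⟨f₀, hf₀⟩
  haveI := nonempty_iSup_basicOpen s hs ⟨f₀, hf₀⟩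
  have h1 : X.presheaf.map (homOfLE (le_iSup W ⟨f₀, hf₀⟩)).op σ = t ⟨f₀, hf₀⟩ := hσ ⟨f₀, hf₀⟩
  rw [← germToFunctionField_map (le_iSup W ⟨f₀, hf₀⟩) σ, h1, hgen]

/-! ## §5 The range statement -/

/-- **`Γ(X, ⋃_{f ∈ s} X.basicOpen f) = ⋂_{f ∈ s} Γ(X, U)[1/f]` inside `K(X)`** (`X` integral, `U` affine, `s` a non-empty finite set of
non-zero sections): a rational function is the germ of a section over `⋃ X.basicOpen f` iff it is `a_f / f^{n_f}` for every `f ∈ s`.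
Together with `Scheme.germToFunctionField_injective` this identifies `Γ(X, ⋃ X.basicOpen f)` with `⋂ Γ(X, U)[1/f] ⊆ K(X)` — the
`hrange` hypothesis of `S2ModificationAffineSections.exists_algEquiv_integralClosure_s2Mod` (after `S2ModificationAffine.mem_awaySub_iff`).
[folklore] [cite: EGAIV2, 5.10.16–17] -/
theorem mem_range_germToFunctionField_iSup_iff (hU : IsAffineOpen U) [Nonempty U] (s : Finset Γ(X, U))
    (hs : ∀ f ∈ s, f ≠ 0) (hne : s.Nonempty) (z : X.functionField) :
    z ∈ Set.range (X.germToFunctionField (⨆ f : s, X.basicOpen (f : Γ(X, U))) (h := nonempty_iSup_basicOpen s hs hne)) ↔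
      ∀ (f : Γ(X, U)) (_ : f ∈ s), ∃ (a : Γ(X, U)) (n : ℕ),
        z = X.germToFunctionField U a * (X.germToFunctionField U (f ^ n))⁻¹ := by
  haveI := nonempty_iSup_basicOpen s hs hne
  constructor
  · rintro ⟨σ, rfl⟩ f hf
    exact exists_eq_div_of_basicOpen_le hU f (hs f hf) (le_iSup (fun g : s => X.basicOpen (g : Γ(X, U))) ⟨f, hf⟩) σ
  · intro hz
    obtain ⟨σ, hσ⟩ := exists_germToFunctionField_eq_of_forall hU s hs hne z hz
    exact ⟨σ, hσ⟩

end Summit.ResolutionOfSingularities.ResolutionOfSingularities.Theorems.FInjectiveMacaulayfication.S2ModificationSections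

end
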